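import Summits.KontsevichZagierPeriods.KontsevichZagierPeriods.Theorems.HurwitzMicroSectorsNormalFormPrincipleM4DilationMoves
import Summits.KontsevichZagierPeriods.KontsevichZagierPeriods.Theorems.HurwitzMicroSectorsNormalFormPrincipleDilogBoxSubSimplex
import Summits.KontsevichZagierPeriods.KontsevichZagierPeriods.Theorems.HurwitzMicroSectorsNormalFormPrincipleLevelOneExistsRepDim
import Literature.NumberTheory.Transcendental.KZProductIdeal

/-!
# `NormalFormPrinciple` (stmt-KontsevichZagierPeriods-3869), line `SketchIdeator1` —
# leaf `stub_boxRigidity`, layer `M4` packages: shared tools of the box-stuffle packages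

Helper file of the lead seat (c9) for the dimension-four campaign of the leaf (`--supports` the
crux; registered entry `m4_box_sub_simplex2`). The four "box-stuffle" packages of the certificate
(`m4_rel_bstuffle13p/13m/22pm/22pp`) realise a quasi-shuffle (stuffle) relation as ONE
integrand-additivity move on a PRODUCT BOX — the three-term partial fraction
`1/((1 − αu)(1 − βv)) = 1/((1 − αu)(1 − αβuv)) + 1/((1 − βv)(1 − αβuv)) − 1/(1 − αβuv)`
(`m4t_stuffle_partialFraction`) — followed by coordinate permutations and cubical charts. This file
collects what they share: the identity; existence of box representations on `□⁴` by domination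
(`m4t_exists_box_of_abs_le`) and of the two level-one boxes `[□⁴, 1/(1 ∓ x₀x₁x₂x₃)]`; the
dimension-two cubical chart `□² → Δ₂`, `(x₀, x₁) ↦ (x₀, x₀x₁)` with Jacobian `x₀`, as a generic
rule-(2) move (`m4_box_sub_simplex2`, from the merge–scale chart of the dilogarithm layer); and the
existence of the dimension-two word representations `[Δ₂, x(t₀) y(t₁)]`, `x ∈ {a, c}`, `y ∈ {b, c}`
(`m4t_exists_wordRep2`, dominated by Kontsevich's `ζ(2)` integrand).
References: M. Kontsevich, D. Zagier, *Periods* (2001), §1.1–1.2; M. E. Hoffman, *The algebra of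
multiple harmonic series*, J. Algebra 194 (1997) (quasi-shuffle). No definitions are introduced.
-/

noncomputable section

open MeasureTheory Set
open Literature.NumberTheory.Transcendental Literature.NumberTheory.Transcendental.KZ
open Literature.ModelTheory.ExponentialFields (IsSemialgebraic)
open Summit.KontsevichZagierPeriods.HurwitzMicroSectors.NormalFormPrinciple.PiBox.Dilog
  (bss_exists_mergeScaleChart bss_image_box_of_pos)

namespace Summit.KontsevichZagierPeriods.HurwitzMicroSectors.NormalFormPrinciple.PiBox.M3

/-! ## The stuffle as a partial fraction -/

/-- **The quasi-shuffle (stuffle) of two geometric factors as a three-term partial fraction.**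
`1/((1 − αu)(1 − βv)) = 1/((1 − αu)(1 − αβuv)) + 1/((1 − βv)(1 − αβuv)) − 1/(1 − αβuv)` whenever
the three denominators are nonzero. [cite: Hoffman1997, §2] -/
theorem m4t_stuffle_partialFraction {α β u v : ℝ} (hu : 1 - α * u ≠ 0) (hv : 1 - β * v ≠ 0)
    (huv : 1 - α * β * (u * v) ≠ 0) :
    1 / ((1 - α * u) * (1 - β * v)) =
      1 / ((1 - α * u) * (1 - α * β * (u * v))) + 1 / ((1 - β * v) * (1 - α * β * (u * v))) -
        1 / (1 - α * β * (u * v)) := by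
  rw [div_add_div _ _ (mul_ne_zero hu huv) (mul_ne_zero hv huv), div_sub_div _ _
    (mul_ne_zero (mul_ne_zero hu huv) (mul_ne_zero hv huv)) huv,
    div_eq_div_iff (mul_ne_zero hu hv)
      (mul_ne_zero (mul_ne_zero (mul_ne_zero hu huv) (mul_ne_zero hv huv)) huv)]
  ring

/-! ## Box representations on `□⁴` -/

/-- **A box representation with a dominated integrand exists.** If `F` is `ℚ`-semialgebraic and
continuous on the open unit box `□⁴` and `|F| ≤ G` there for some `G` integrable on `□⁴`, then
`[□⁴, F]` is an integral representation. [cite: KontsevichZagier2001, §1.1] -/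
theorem m4t_exists_box_of_abs_le {F G : (Fin 4 → ℝ) → ℝ}
    (hF : IsSemialgebraicFunOn ℚ {x : Fin 4 → ℝ | ∀ i, x i ∈ Set.Ioo (0:ℝ) 1} F)
    (hFc : ContinuousOn F {x : Fin 4 → ℝ | ∀ i, x i ∈ Set.Ioo (0:ℝ) 1})
    (hG : IntegrableOn G {x : Fin 4 → ℝ | ∀ i, x i ∈ Set.Ioo (0:ℝ) 1})
    (hle : ∀ x ∈ {x : Fin 4 → ℝ | ∀ i, x i ∈ Set.Ioo (0:ℝ) 1}, |F x| ≤ G x) :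
    ∃ N : IntegralRep 4, N.domain = {x | ∀ i, x i ∈ Set.Ioo (0:ℝ) 1} ∧ N.integrand = F := by
  have hm : MeasurableSet {x : Fin 4 → ℝ | ∀ i, x i ∈ Set.Ioo (0:ℝ) 1} :=
    (isSemialgebraic_box 4).measurableSet_holds
  refine ⟨⟨_, F, isSemialgebraic_box 4, hF, ?_⟩, rfl, rfl⟩
  refine Integrable.mono' hG (hFc.aestronglyMeasurable hm) ?_
  exact (ae_restrict_iff' hm).2 (Filter.Eventually.of_forall
    fun x hx => (Real.norm_eq_abs _).le.trans (hle x hx))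

/-- **The level-one box `[□⁴, 1/(1 − x₀x₁x₂x₃)]` exists** (Kontsevich–Zagier's `ζ(4)` box; the
level-one integrability lemma of the `LevelOne` layer in dimension `4`). [cite: KontsevichZagier2001, §1.1] -/
theorem m4t_exists_minusBox4 :
    ∃ Z : IntegralRep 4, Z.domain = {x | ∀ i, x i ∈ Set.Ioo (0:ℝ) 1} ∧
      Z.integrand = fun x => 1 / (1 - x 0 * x 1 * x 2 * x 3) := by
  have he : ∀ x : Fin 4 → ℝ,
      (MvPolynomial.aeval x (1 : MvPolynomial (Fin 4) ℚ) : ℝ) / (1 - ∏ i, x i) =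
        1 / (1 - x 0 * x 1 * x 2 * x 3) := fun x => by
    rw [map_one, Fin.prod_univ_four]
  have hsa : IsSemialgebraicFunOn ℚ {x : Fin 4 → ℝ | ∀ i, x i ∈ Set.Ioo (0:ℝ) 1}
      (fun x => 1 / (1 - x 0 * x 1 * x 2 * x 3)) :=
    (LevelOne.isSemialgebraicFunOn_aeval_div_one_sub_prod_dim (w := 4) (by norm_num) 1).congr
      fun x _ => he x
  have hint : IntegrableOn (fun x : Fin 4 → ℝ => 1 / (1 - x 0 * x 1 * x 2 * x 3))
      {x | ∀ i, x i ∈ Set.Ioo (0:ℝ) 1} :=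
    (LevelOne.integrableOn_aeval_div_one_sub_prod_dim (w := 4) (by norm_num) 1).congr_fun
      (fun x _ => he x) (isSemialgebraic_box 4).measurableSet_holds
  exact ⟨⟨_, _, isSemialgebraic_box 4, hsa, hint⟩, rfl, rfl⟩

/-- **The box `[□⁴, 1/(1 + x₀x₁x₂x₃)]` exists** (the `η(4)` box: denominator `≥ 1`, bounded and
continuous on the closed cube). [cite: KontsevichZagier2001, §1.1] -/
theorem m4t_exists_plusBox4 :
    ∃ Z : IntegralRep 4, Z.domain = {x | ∀ i, x i ∈ Set.Ioo (0:ℝ) 1} ∧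
      Z.integrand = fun x => 1 / (1 + x 0 * x 1 * x 2 * x 3) := by
  have hB := isSemialgebraic_box 4
  have hsa : IsSemialgebraicFunOn ℚ {x : Fin 4 → ℝ | ∀ i, x i ∈ Set.Ioo (0:ℝ) 1}
      (fun x => 1 / (1 + x 0 * x 1 * x 2 * x 3)) := by
    refine (isSemialgebraicFunOn_aeval_div_aeval hB (1 : MvPolynomial (Fin 4) ℚ)
      (1 + MvPolynomial.X 0 * MvPolynomial.X 1 * MvPolynomial.X 2 * MvPolynomial.X 3)
      fun x hx => ?_).congr fun x _ => ?_
    · simp only [map_add, map_one, map_mul, MvPolynomial.aeval_X]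
      have h0 := (hx 0).1; have h1 := (hx 1).1; have h2 := (hx 2).1; have h3 := (hx 3).1
      positivity
    · simp only [map_add, map_one, map_mul, MvPolynomial.aeval_X]
  have hint : IntegrableOn (fun x : Fin 4 → ℝ => 1 / (1 + x 0 * x 1 * x 2 * x 3))
      {x : Fin 4 → ℝ | ∀ i, x i ∈ Set.Ioo (0:ℝ) 1} := by
    have hc : ContinuousOn (fun x : Fin 4 → ℝ => 1 / (1 + x 0 * x 1 * x 2 * x 3)) (Set.Icc 0 1) :=
      continuousOn_const.div (by fun_prop) fun x hx => by
        have h0 : (0:ℝ) ≤ x 0 := hx.1 0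
        have h1 : (0:ℝ) ≤ x 1 := hx.1 1
        have h2 : (0:ℝ) ≤ x 2 := hx.1 2
        have h3 : (0:ℝ) ≤ x 3 := hx.1 3
        positivity
    exact (hc.integrableOn_compact isCompact_Icc).mono_set
      fun x hx => ⟨fun i => (hx i).1.le, fun i => (hx i).2.le⟩
  exact ⟨⟨_, _, hB, hsa, hint⟩, rfl, rfl⟩

/-! ## Dimension two: the cubical chart and the word representations -/

/-- **Registered entry (`m4_box_sub_simplex2`).** The dimension-two cubical chart
`Φ(x₀, x₁) = (x₀, x₀x₁)` maps the open unit box `□²` onto the decreasing open simplex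
`Δ₂ = {0 < t₁ < t₀ < 1}` with Jacobian `x₀`; for a generic integrand `g` on `Δ₂` and any
representations `N = [□², ≡ g(Φx)·x₀]`, `T = [Δ₂, ≡ g]`, `[N] − [T]` is ONE change-of-variables move
(the merge–scale chart `bss_exists_mergeScaleChart` of the dilogarithm layer with scale `1`).
[cite: KontsevichZagier2001, §1.2 rule (2)] -/
theorem m4_box_sub_simplex2 :
    ∀ (g : (Fin 2 → ℝ) → ℝ) (N T : IntegralRep 2),
      N.domain = {x | ∀ i, x i ∈ Set.Ioo (0:ℝ) 1} →
      T.domain = {t | 0 < t 1 ∧ t 1 < t 0 ∧ t 0 < 1} →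
      EqOn T.integrand g T.domain →
      EqOn N.integrand (fun x => g ![x 0, x 0 * x 1] * x 0) N.domain →
      of N - of T ∈ relations := by
  intro g N T hNd hTd hTg hNi
  obtain ⟨Φ, Φ', hΦ0, hΦ1, hsa, hderiv, hinj, hdet⟩ :=
    bss_exists_mergeScaleChart (s := (1:ℝ)) isAlgebraic_one one_ne_zero
  have himage : T.domain = Φ '' N.domain := by
    rw [hNd, bss_image_box_of_pos one_pos hΦ0 hΦ1, hTd]
  have hsa' : IsSemialgebraicMapOn ℚ N.domain Φ := by rw [hNd]; exact hsa
  have hinj' : InjOn Φ N.domain := by rw [hNd]; exact hinj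
  refine changeOfVariablesRel_subset_relations
    ⟨2, N, T, Φ, Φ', hsa', fun x _ => (hderiv x).hasFDerivWithinAt, hinj', himage,
      fun x hx => ?_, rfl⟩
  have hΦx : Φ x ∈ T.domain := himage ▸ mem_image_of_mem _ hx
  have hx' : ∀ i, x i ∈ Set.Ioo (0:ℝ) 1 := by rw [hNd] at hx; exact hx
  have hΦeq : Φ x = ![x 0, x 0 * x 1] := by
    ext i
    fin_cases i
    · simpa using hΦ0 x
    · simpa using hΦ1 x
  rw [hNi hx, hTg hΦx, hdet x hx', hΦeq]
  simp only [one_pow, one_mul]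

/-- The `ζ(2)` integrand `1/(t₀(1 − t₁))` is absolutely integrable on `Δ₂` (Kontsevich's iterated
integral for `ζ(2)`, `KZ.mzvIntegrand_integrableOn_holds [2]`). [cite: Zagier1994, §9] -/
theorem m4t_integrableOn_zetaTwo :
    IntegrableOn (fun t : Fin 2 → ℝ => 1 / t 0 * (1 / (1 - t 1)))
      {t : Fin 2 → ℝ | 0 < t 1 ∧ t 1 < t 0 ∧ t 0 < 1} := by
  have h : IntegrableOn (mzvIntegrand [2]) (openOrderedSimplex 2) volume :=
    mzvIntegrand_integrableOn_holds [2] (by decide)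
  rw [m4d_simplex2_eq_openOrderedSimplex]
  refine h.congr_fun (fun t _ => ?_) (measurableSet_openOrderedSimplex 2)
  show (∏ i : Fin 2, mzvForm ([false, true].getD i false) (t i)) = _
  rw [Fin.prod_univ_two]
  rfl

/-- **The dimension-two word representations exist.** For letters `x ∈ {a, c}` and `y ∈ {b, c}`
(`a u = 1/u`, `b u = 1/(1−u)`, `c u = 1/(1+u)`), `[Δ₂, x(t₀) y(t₁)]` is an integral representation:
the integrand is a quotient of `ℚ`-polynomials nonvanishing on `Δ₂`, continuous there, and
dominated by the `ζ(2)` integrand `1/(t₀(1 − t₁))`. [cite: KontsevichZagier2001, §1.1] -/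
theorem m4t_exists_wordRep2 :
    ∀ (x y : ℝ → ℝ),
      x ∈ ({fun u => 1 / u, fun u => 1 / (1 + u)} : Set (ℝ → ℝ)) →
      y ∈ ({fun u => 1 / (1 - u), fun u => 1 / (1 + u)} : Set (ℝ → ℝ)) →
      ∃ T : IntegralRep 2, T.domain = {t | 0 < t 1 ∧ t 1 < t 0 ∧ t 0 < 1} ∧
        T.integrand = fun t => x (t 0) * y (t 1) := by
  intro x y hx hy
  have hΔ : IsSemialgebraic ℚ {t : Fin 2 → ℝ | 0 < t 1 ∧ t 1 < t 0 ∧ t 0 < 1} := by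
    rw [m4d_simplex2_eq_openOrderedSimplex]; exact isSemialgebraic_openOrderedSimplex 2
  have hm : MeasurableSet {t : Fin 2 → ℝ | 0 < t 1 ∧ t 1 < t 0 ∧ t 0 < 1} := by
    rw [m4d_simplex2_eq_openOrderedSimplex]; exact measurableSet_openOrderedSimplex 2
  -- the integrand as a quotient of polynomials `1 / (p(t₀) q(t₁))`, with its bound
  obtain ⟨p, hp, hpx, hxle⟩ : ∃ p : MvPolynomial (Fin 2) ℚ,
      (∀ t ∈ {t : Fin 2 → ℝ | 0 < t 1 ∧ t 1 < t 0 ∧ t 0 < 1}, 0 < (MvPolynomial.aeval t p : ℝ)) ∧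
      (∀ t : Fin 2 → ℝ, x (t 0) = 1 / MvPolynomial.aeval t p) ∧
      (∀ t ∈ {t : Fin 2 → ℝ | 0 < t 1 ∧ t 1 < t 0 ∧ t 0 < 1}, |x (t 0)| ≤ 1 / t 0) := by
    simp only [Set.mem_insert_iff, Set.mem_singleton_iff] at hx
    rcases hx with rfl | rfl
    · refine ⟨MvPolynomial.X 0, fun t ht => ?_, fun t => ?_, fun t ht => ?_⟩
      · simp only [MvPolynomial.aeval_X]; exact ht.1.trans ht.2.1
      · simp only [MvPolynomial.aeval_X]
      · rw [abs_of_pos (one_div_pos.2 (ht.1.trans ht.2.1))]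
    · refine ⟨1 + MvPolynomial.X 0, fun t ht => ?_, fun t => ?_, fun t ht => ?_⟩
      · simp only [map_add, map_one, MvPolynomial.aeval_X]; linarith [ht.1.trans ht.2.1]
      · simp only [map_add, map_one, MvPolynomial.aeval_X]
      · have h0 : 0 < t 0 := ht.1.trans ht.2.1
        rw [abs_of_pos (one_div_pos.2 (by linarith))]
        exact one_div_le_one_div_of_le h0 (by linarith)
  obtain ⟨q, hq, hqy, hyle⟩ : ∃ q : MvPolynomial (Fin 2) ℚ,
      (∀ t ∈ {t : Fin 2 → ℝ | 0 < t 1 ∧ t 1 < t 0 ∧ t 0 < 1}, 0 < (MvPolynomial.aeval t q : ℝ)) ∧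
      (∀ t : Fin 2 → ℝ, y (t 1) = 1 / MvPolynomial.aeval t q) ∧
      (∀ t ∈ {t : Fin 2 → ℝ | 0 < t 1 ∧ t 1 < t 0 ∧ t 0 < 1}, |y (t 1)| ≤ 1 / (1 - t 1)) := by
    simp only [Set.mem_insert_iff, Set.mem_singleton_iff] at hy
    rcases hy with rfl | rfl
    · refine ⟨1 - MvPolynomial.X 1, fun t ht => ?_, fun t => ?_, fun t ht => ?_⟩
      · simp only [map_sub, map_one, MvPolynomial.aeval_X]; linarith [ht.2.1.trans ht.2.2]
      · simp only [map_sub, map_one, MvPolynomial.aeval_X]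
      · rw [abs_of_pos (one_div_pos.2 (by linarith [ht.2.1.trans ht.2.2]))]
    · refine ⟨1 + MvPolynomial.X 1, fun t ht => ?_, fun t => ?_, fun t ht => ?_⟩
      · simp only [map_add, map_one, MvPolynomial.aeval_X]; linarith [ht.1]
      · simp only [map_add, map_one, MvPolynomial.aeval_X]
      · have h1 : 0 < 1 - t 1 := by linarith [ht.2.1.trans ht.2.2]
        rw [abs_of_pos (one_div_pos.2 (by linarith [ht.1]))]
        exact one_div_le_one_div_of_le h1 (by linarith [ht.1])
  have hpq : ∀ t ∈ {t : Fin 2 → ℝ | 0 < t 1 ∧ t 1 < t 0 ∧ t 0 < 1},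
      (MvPolynomial.aeval t (p * q) : ℝ) ≠ 0 := fun t ht => by
    rw [map_mul]; exact (mul_pos (hp t ht) (hq t ht)).ne'
  have hF : ∀ t, x (t 0) * y (t 1) = (MvPolynomial.aeval t (1 : MvPolynomial (Fin 2) ℚ) : ℝ) /
      MvPolynomial.aeval t (p * q) := fun t => by
    rw [hpx, hqy, map_one, map_mul, one_div_mul_one_div]
  have hsa : IsSemialgebraicFunOn ℚ {t : Fin 2 → ℝ | 0 < t 1 ∧ t 1 < t 0 ∧ t 0 < 1}
      (fun t => x (t 0) * y (t 1)) :=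
    (isSemialgebraicFunOn_aeval_div_aeval hΔ 1 (p * q) hpq).congr fun t _ => (hF t).symm
  have hcont : ContinuousOn (fun t : Fin 2 → ℝ => x (t 0) * y (t 1))
      {t : Fin 2 → ℝ | 0 < t 1 ∧ t 1 < t 0 ∧ t 0 < 1} := by
    refine (ContinuousOn.div (Literature.ModelTheory.ExponentialFields.continuous_aeval_real _).continuousOn
      (Literature.ModelTheory.ExponentialFields.continuous_aeval_real (p * q)).continuousOn hpq).congr
      fun t _ => hF t
  refine ⟨⟨_, _, hΔ, hsa, ?_⟩, rfl, rfl⟩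
  refine Integrable.mono' m4t_integrableOn_zetaTwo (hcont.aestronglyMeasurable hm) ?_
  refine (ae_restrict_iff' hm).2 (Filter.Eventually.of_forall fun t ht => ?_)
  rw [Real.norm_eq_abs, abs_mul]
  have h0 : 0 < t 0 := ht.1.trans ht.2.1
  exact mul_le_mul (hxle t ht) (hyle t ht) (abs_nonneg _) (one_div_pos.2 h0).le

end Summit.KontsevichZagierPeriods.HurwitzMicroSectors.NormalFormPrinciple.PiBox.M3
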